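import Summits.AtomisticToContinuum.Crystallization.Theorems.BrittleRungDescentMieRungLimit
import Summits.AtomisticToContinuum.Crystallization.Theorems.BrittleRungDescentMieRungMatched
import Summits.AtomisticToContinuum.Crystallization.Theorems.BrittleRungDescentMieRungFinite
import Literature.MathematicalPhysics.StatisticalMechanics.CrystallizationSymmetries

/-!
# Route `BrittleRungDescent`, item `MieRung` (stmt-AtomisticToContinuum-10946): the energetic
# conjunct for a general Lennard-Jones-like pair potential, V — periodic local limits are
# periodic minimisers; the Blanc–Lewin form implies the energetic form

Part V (conclusion) of the generic-`V` series.  HYPOTHESES on the pair potential `V : ℝ → ℝ`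
(all satisfied by every rung `miePotential q`, `q ≥ 6`, of the Mie ladder and by `lennardJones`):
`hV0 : V 0 = 0`; `hfar : V ≤ 0` on `[1, ∞)`; `h6 : -A r⁻⁶ ≤ V(r)` on `(0, ∞)` (`A ≥ 0`);
`hcont : ContinuousOn V (Ioi 0)`; `hstab` (stability `−C·N ≤ 𝓔_V`); ground states exist for
every `N` (`hex`) and are uniformly `δ`-separated (`hsep`, `δ > 0`).  MAIN RESULTS:

* `energyPerParticle_le_iInf_of_isLocalLimit` — if the point set of a periodic configuration `P`
  is a local limit of translated ground states of `V` (`IsLocalLimitOfGroundStates V 3 P.points`),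
  then `e_V(P) ≤ e_* = ⨅_Q e_V(Q)`, hence `e_V(P) = e_*` (`energyPerParticle_eq_iInf_of_isLocalLimit`):
  **periodic local limits of translated ground states are periodic minimisers**.  Mechanism as in
  the tree's Lennard-Jones file `ThreeConeCertificateKeplerBoundLocLimMain`: a block of `P` matched
  inside a ground state, the removal inequality (part IV), the matched block estimates (part III),
  the trial-state and thermodynamic-limit bounds (parts I–II).
* `hasPeriodicGroundStateEnergy_of_isLocalLimit` — hence `HasPeriodicGroundStateEnergy V 3`
  (with that `P`: least periodic energy per particle, and `E_V(N)/N → e_V(P)` by part II).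
* `hasPeriodicGroundStateEnergy_of_isCrystallizing` — **`IsCrystallizing V 3 →
  HasPeriodicGroundStateEnergy V 3`**: for uniformly separated ground states the Blanc–Lewin
  form of crystallization (conjunct (ii)) already implies the energetic form (conjunct (i)).

All `[folklore]` (Blanc–Lewin 2015, §2: local optimality of limits of minimisers).
-/

noncomputable section

open scoped BigOperators Topology
open Filter Set Metric

namespace Summit.AtomisticToContinuum.Crystallization.Theorems.MieRungEnergetic

open Literature.MathematicalPhysics.StatisticalMechanics
open Summit.AtomisticToContinuum.Crystallization.Theorems.ChargedEnergyGapNegative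
open Summit.AtomisticToContinuum.Crystallization.Theorems.ChargedEnergyGapNegative.Blocks

variable {V : ℝ → ℝ} {A C : ℝ}

/-- **Periodic local limits of translated ground states have energy per particle `≤ e_*`.**
[folklore] -/
theorem energyPerParticle_le_iInf_of_isLocalLimit (hV0 : V 0 = 0)
    (hfar : ∀ r, 1 ≤ r → V r ≤ 0) (h6 : ∀ r, 0 < r → -(A * r⁻¹ ^ 6) ≤ V r) (hA : 0 ≤ A)
    (hcont : ContinuousOn V (Set.Ioi 0))
    (hstab : ∀ (n : ℕ) (y : Fin n → E3), Function.Injective y →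
      -(C * n) ≤ interactionEnergy V y)
    (hex : ∀ n : ℕ, ∃ z : Fin n → E3, IsGroundState V z) {δ : ℝ} (hδ : 0 < δ)
    (hsepgs : ∀ (N : ℕ) (x : Fin N → E3), IsGroundState V x →
      ∀ i j, i ≠ j → δ ≤ dist (x i) (x j))
    {P : PeriodicConfiguration 3} (h : IsLocalLimitOfGroundStates V 3 P.points) :
    P.energyPerParticle V ≤ ⨅ Q : PeriodicConfiguration 3, Q.energyPerParticle V := by
  classical
  set eStarV : ℝ := ⨅ Q : PeriodicConfiguration 3, Q.energyPerParticle V with hes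
  have hPsep : ∀ p ∈ P.points, ∀ q ∈ P.points, p ≠ q → δ ≤ dist p q :=
    fun p hp q hq hpq => h.le_dist hsepgs hp hq hpq
  obtain ⟨x, σ, τ, hx, -, hlim⟩ := h
  refine le_of_forall_pos_le_add fun κ hκ => ?_
  set e : ℝ := P.energyPerParticle V with he
  have hF : 1 ≤ P.motif.card := P.motif_nonempty.card_pos
  -- (1) the block size
  obtain ⟨K₁, -, hK₁⟩ := exists_block_energy_le P hV0 hfar h6 hA (show 0 < κ / 8 by positivity)
  have hlt : eStarV < eStarV + κ / 8 := by linarith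
  have hev : ∀ᶠ m : ℕ in atTop, groundStateEnergy V 3 m / m < eStarV + κ / 8 :=
    (tendsto_order.1 (tendsto_groundStateEnergy_div hV0 hfar h6 hA hstab)).2 _ hlt
  obtain ⟨n₀, hn₀⟩ := eventually_atTop.1 hev
  set K : ℕ := max K₁ (max n₀ 1) with hK
  have hKK₁ : K₁ ≤ K := le_max_left _ _
  have hKn₀ : n₀ ≤ K := (le_max_left _ _).trans (le_max_right _ _)
  have hK1 : 1 ≤ K := (le_max_right _ _).trans (le_max_right _ _)
  set n : ℕ := Fintype.card (BIdx P K) with hn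
  have hn_eq : n = P.motif.card * K ^ 3 := card_BIdx P K
  have hnK : K ≤ n := by
    rw [hn_eq]
    calc K = 1 * K ^ 1 := by ring
      _ ≤ P.motif.card * K ^ 3 :=
        Nat.mul_le_mul hF (Nat.pow_le_pow_right hK1 (by norm_num))
  have hn1 : 1 ≤ n := hK1.trans hnK
  have hnpos : (0 : ℝ) < n := by exact_mod_cast hn1
  have hEn : groundStateEnergy V 3 n ≤ n * (eStarV + κ / 8) := by
    have := hn₀ n (hKn₀.trans hnK)
    rw [div_lt_iff₀ hnpos] at this
    linarith
  have hblock : interactionEnergy V (blockConfig P K) ≤ n * (e + κ / 8) := hK₁ K hKK₁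
  -- (2) the truncation radius
  set C₅ : ℝ := A * (250 * δ⁻¹ ^ 5) + 1 with hC₅
  have hC₅pos : 0 < C₅ := by positivity
  obtain ⟨t₀, ht₀2, htail⟩ : ∃ t₀ : ℝ, 2 ≤ t₀ ∧ A * ((t₀ - 1)⁻¹ * (250 * δ⁻¹ ^ 5)) ≤ κ / 8 := by
    refine ⟨2 + C₅ / (κ / 8), ?_, ?_⟩
    · have : 0 ≤ C₅ / (κ / 8) := by positivity
      linarith
    · have hR1pos : 0 < 2 + C₅ / (κ / 8) - 1 := by
        have : 0 ≤ C₅ / (κ / 8) := by positivity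
        linarith
      have hinv : (2 + C₅ / (κ / 8) - 1)⁻¹ ≤ (κ / 8) / C₅ := by
        rw [inv_le_comm₀ hR1pos (by positivity), inv_div]
        linarith
      have hA5 : 0 ≤ A * (250 * δ⁻¹ ^ 5) := by positivity
      calc A * ((2 + C₅ / (κ / 8) - 1)⁻¹ * (250 * δ⁻¹ ^ 5))
          = A * (250 * δ⁻¹ ^ 5) * (2 + C₅ / (κ / 8) - 1)⁻¹ := by ring
        _ ≤ C₅ * (2 + C₅ / (κ / 8) - 1)⁻¹ :=
            mul_le_mul_of_nonneg_right (by rw [hC₅]; linarith) (inv_nonneg.2 hR1pos.le)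
        _ ≤ C₅ * ((κ / 8) / C₅) := mul_le_mul_of_nonneg_left hinv hC₅pos.le
        _ = κ / 8 := by field_simp
  have ht₀0 : 0 ≤ t₀ := by linarith
  -- (3) the moduli
  set M : ℝ := (2 * t₀ / δ + 1) ^ 3 with hM
  have hM0 : 0 ≤ M := by positivity
  obtain ⟨ω, hωpos, hMω⟩ : ∃ ω : ℝ, 0 < ω ∧ M * ω ≤ κ / 8 := by
    refine ⟨κ / 8 / (M + 1), by positivity, ?_⟩
    rw [mul_div_assoc', div_le_iff₀ (by positivity)]
    nlinarith
  obtain ⟨ω₂, hω₂pos, hnω₂⟩ : ∃ ω₂ : ℝ, 0 < ω₂ ∧ (n : ℝ) * ω₂ ≤ κ / 4 := by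
    refine ⟨κ / 4 / (n + 1), by positivity, ?_⟩
    rw [mul_div_assoc', div_le_iff₀ (by positivity)]
    nlinarith
  -- (4) block geometry
  set D₀ : ℝ := ∑ u : BIdx P K, ‖bpt P K u‖ with hD₀
  have hD₀u : ∀ u, ‖bpt P K u‖ ≤ D₀ := fun u =>
    Finset.single_le_sum (f := fun u => ‖bpt P K u‖) (fun _ _ => norm_nonneg _) (Finset.mem_univ u)
  have hD : ∀ u v, dist (bpt P K u) (bpt P K v) ≤ 2 * D₀ := fun u v =>
    (dist_le_norm_add_norm _ _).trans (by linarith [hD₀u u, hD₀u v])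
  -- (5) the tolerance, from uniform continuity of `V` on `[δ, Rm]`
  set Rm : ℝ := max (t₀ + 1) (2 * D₀ + 1) with hRm
  have hcont' : ContinuousOn V (Set.Icc δ Rm) :=
    hcont.mono fun s hs => (hδ.trans_le hs.1 : (0 : ℝ) < s)
  obtain ⟨ε₀, hε₀, hmod⟩ := Metric.uniformContinuousOn_iff_le.1
    (isCompact_Icc.uniformContinuousOn_of_continuous hcont') (min ω ω₂) (lt_min hωpos hω₂pos)
  obtain ⟨ε, hε, hεε₀, hεδ, hε1⟩ : ∃ ε : ℝ, 0 < ε ∧ 2 * ε ≤ ε₀ ∧ 4 * ε < δ ∧ 2 * ε ≤ 1 := by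
    refine ⟨min (ε₀ / 2) (min (δ / 8) (1 / 2)), ?_, ?_, ?_, ?_⟩
    · exact lt_min (by linarith) (lt_min (by linarith) (by norm_num))
    · linarith [min_le_left (ε₀ / 2) (min (δ / 8) (1 / 2))]
    · linarith [min_le_right (ε₀ / 2) (min (δ / 8) (1 / 2)), min_le_left (δ / 8) (1 / 2 : ℝ)]
    · linarith [min_le_right (ε₀ / 2) (min (δ / 8) (1 / 2)), min_le_right (δ / 8) (1 / 2 : ℝ)]
  have hmod' : ∀ B : ℝ, B ≤ Rm → ∀ s t : ℝ, δ ≤ s → δ ≤ t → s ≤ B → t ≤ B → |s - t| ≤ 2 * ε →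
      |V s - V t| ≤ min ω ω₂ := by
    intro B hB s t hs ht hsB htB hst
    have := hmod s ⟨hs, hsB.trans hB⟩ t ⟨ht, htB.trans hB⟩ (by rw [Real.dist_eq]; linarith)
    rwa [Real.dist_eq] at this
  have hωmod : ∀ s t : ℝ, δ ≤ s → δ ≤ t → s ≤ t₀ + 1 → t ≤ t₀ + 1 → |s - t| ≤ 2 * ε →
      |V s - V t| ≤ ω := fun s t hs ht hsB htB hst =>
    (hmod' _ (le_max_left _ _) s t hs ht hsB htB hst).trans (min_le_left _ _)
  have hω₂mod : ∀ s t : ℝ, δ ≤ s → δ ≤ t → s ≤ 2 * D₀ + 1 → t ≤ 2 * D₀ + 1 → |s - t| ≤ 2 * ε →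
      |V s - V t| ≤ ω₂ := fun s t hs ht hsB htB hst =>
    (hmod' _ (le_max_right _ _) s t hs ht hsB htB hst).trans (min_le_right _ _)
  -- (6) a ground state matched with `P` beyond the block
  set L : ℝ := D₀ + t₀ + 2 with hL
  obtain ⟨j, hm1, hm2⟩ := (hlim L ε hε).exists
  set y : Fin (σ j) → E3 := fun i => x (σ j) i + τ j with hy
  have hyg : IsGroundState V y := (isGroundState_add_const_iff V (τ j)).2 (hx (σ j))
  have hysep : ∀ k l : Fin (σ j), k ≠ l → δ ≤ dist (y k) (y l) := hsepgs _ y hyg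
  have hm1' : ∀ q ∈ P.points, ‖q‖ ≤ L → ∃ i, dist (y i) q ≤ ε := hm1
  have hm2' : ∀ i, ‖y i‖ ≤ L → ∃ q ∈ P.points, dist (y i) q ≤ ε := hm2
  -- (7) the particles at the block points
  have hchoice : ∀ u : BIdx P K, ∃ i, dist (y i) (bpt P K u) ≤ ε := fun u =>
    hm1' _ (bpt_mem P K u) (by rw [hL]; linarith [hD₀u u])
  choose i hi using hchoice
  have hinj : Function.Injective i := by
    intro u v huv
    by_contra hne
    have hne' : bpt P K u ≠ bpt P K v := fun h' => hne (bpt_injective P K h')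
    have h1 := hPsep _ (bpt_mem P K u) _ (bpt_mem P K v) hne'
    have h2 : dist (bpt P K u) (bpt P K v) ≤ 2 * ε :=
      calc dist (bpt P K u) (bpt P K v) ≤ dist (bpt P K u) (y (i u)) + dist (y (i u)) (bpt P K v) :=
            dist_triangle _ _ _
        _ ≤ ε + ε := by
            refine add_le_add ?_ ?_
            · rw [dist_comm]; exact hi u
            · rw [huv]; exact hi v
        _ = 2 * ε := by ring
    linarith
  have hLu : ∀ u, ‖bpt P K u‖ + t₀ + 1 ≤ L := fun u => by rw [hL]; linarith [hD₀u u]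
  -- (8) the two block estimates
  have hsite := sum_siteEnergy_block_ge hfar h6 hA i hm1' hm2' hLu hi hysep hPsep hδ hε.le hεδ hε1
    ht₀2 hωpos.le hωmod
  have hpair := sum_sum_block_le hV0 i hinj hi hysep hPsep hε1 hD hω₂pos.le hω₂mod
  -- (9) the removal inequality on `S = image i`
  set S : Finset (Fin (σ j)) := Finset.univ.image i with hS
  have hScard : S.card = n := by
    rw [hS, Finset.card_image_of_injective _ hinj, Finset.card_univ]
  have hrem := sum_siteEnergy_sub_le_groundStateEnergy hV0 hfar hstab hex hyg S
  have hsumS : ∀ f : Fin (σ j) → ℝ, ∑ k ∈ S, f k = ∑ u : BIdx P K, f (i u) := fun f => by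
    rw [hS, Finset.sum_image fun u _ v _ huv => hinj huv]
  have hS1 : ∑ k ∈ S, siteEnergy V y k = ∑ u : BIdx P K, siteEnergy V y (i u) := hsumS _
  have hS2 : ∑ k ∈ S, ∑ l ∈ S, V (dist (y k) (y l)) =
      ∑ u : BIdx P K, ∑ v : BIdx P K, V (dist (y (i u)) (y (i v))) := by
    rw [hsumS]
    exact Finset.sum_congr rfl fun u _ => hsumS _
  rw [hS1, hS2, hScard] at hrem
  -- (10) combine
  have hcast : ((Fintype.card (BIdx P K) : ℕ) : ℝ) = (n : ℝ) := by rw [hn]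
  simp only [hcast] at hsite hpair
  rw [← he] at hsite
  have hn2 : ((n : ℝ)) ^ 2 * ω₂ ≤ n * (κ / 4) := by
    rw [sq, mul_assoc]
    exact mul_le_mul_of_nonneg_left hnω₂ hnpos.le
  have h5 : (n : ℝ) * (M * ω + A * ((t₀ - 1)⁻¹ * (250 * δ⁻¹ ^ 5))) ≤ n * (κ / 4) :=
    mul_le_mul_of_nonneg_left (by linarith) hnpos.le
  have h6' : 0 ≤ (n : ℝ) * κ := by positivity
  have key : (n : ℝ) * e ≤ n * (eStarV + κ) := by linarith
  exact le_of_mul_le_mul_left key hnpos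

/-- Hence **`e_V(P) = e_*`**: a periodic local limit of translated ground states is a periodic
minimiser. [folklore] -/
theorem energyPerParticle_eq_iInf_of_isLocalLimit (hV0 : V 0 = 0)
    (hfar : ∀ r, 1 ≤ r → V r ≤ 0) (h6 : ∀ r, 0 < r → -(A * r⁻¹ ^ 6) ≤ V r) (hA : 0 ≤ A)
    (hcont : ContinuousOn V (Set.Ioi 0))
    (hstab : ∀ (n : ℕ) (y : Fin n → E3), Function.Injective y →
      -(C * n) ≤ interactionEnergy V y)
    (hex : ∀ n : ℕ, ∃ z : Fin n → E3, IsGroundState V z) {δ : ℝ} (hδ : 0 < δ)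
    (hsepgs : ∀ (N : ℕ) (x : Fin N → E3), IsGroundState V x →
      ∀ i j, i ≠ j → δ ≤ dist (x i) (x j))
    {P : PeriodicConfiguration 3} (h : IsLocalLimitOfGroundStates V 3 P.points) :
    P.energyPerParticle V = ⨅ Q : PeriodicConfiguration 3, Q.energyPerParticle V :=
  le_antisymm (energyPerParticle_le_iInf_of_isLocalLimit hV0 hfar h6 hA hcont hstab hex hδ hsepgs h)
    (iInf_le_energyPerParticle P hV0 hfar h6 hA hstab)

/-- **The energetic conjunct from a periodic local limit of translated ground states**: if
`P.points ∈ 𝔏`, then `HasPeriodicGroundStateEnergy V 3` — with this very `P`: it attains the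
least periodic energy per particle, and `E_V(N)/N → e_V(P)`. [folklore] -/
theorem hasPeriodicGroundStateEnergy_of_isLocalLimit (hV0 : V 0 = 0)
    (hfar : ∀ r, 1 ≤ r → V r ≤ 0) (h6 : ∀ r, 0 < r → -(A * r⁻¹ ^ 6) ≤ V r) (hA : 0 ≤ A)
    (hcont : ContinuousOn V (Set.Ioi 0))
    (hstab : ∀ (n : ℕ) (y : Fin n → E3), Function.Injective y →
      -(C * n) ≤ interactionEnergy V y)
    (hex : ∀ n : ℕ, ∃ z : Fin n → E3, IsGroundState V z) {δ : ℝ} (hδ : 0 < δ)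
    (hsepgs : ∀ (N : ℕ) (x : Fin N → E3), IsGroundState V x →
      ∀ i j, i ≠ j → δ ≤ dist (x i) (x j))
    {P : PeriodicConfiguration 3} (h : IsLocalLimitOfGroundStates V 3 P.points) :
    HasPeriodicGroundStateEnergy V 3 := by
  have heq := energyPerParticle_eq_iInf_of_isLocalLimit hV0 hfar h6 hA hcont hstab hex hδ hsepgs h
  refine ⟨P, ⟨⟨P, rfl⟩, ?_⟩, ?_⟩
  · rintro _ ⟨Q, rfl⟩
    rw [heq]
    exact iInf_le_energyPerParticle Q hV0 hfar h6 hA hstab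
  · rw [heq]
    exact tendsto_groundStateEnergy_div hV0 hfar h6 hA hstab

/-- **Conjunct (ii) implies conjunct (i) for Lennard-Jones-like potentials**: if the ground
states of `V` in `ℝ³` exist for all `N` and are uniformly separated, then
`IsCrystallizing V 3 → HasPeriodicGroundStateEnergy V 3`. [folklore] -/
theorem hasPeriodicGroundStateEnergy_of_isCrystallizing (hV0 : V 0 = 0)
    (hfar : ∀ r, 1 ≤ r → V r ≤ 0) (h6 : ∀ r, 0 < r → -(A * r⁻¹ ^ 6) ≤ V r) (hA : 0 ≤ A)
    (hcont : ContinuousOn V (Set.Ioi 0))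
    (hstab : ∀ (n : ℕ) (y : Fin n → E3), Function.Injective y →
      -(C * n) ≤ interactionEnergy V y)
    (hex : ∀ n : ℕ, ∃ z : Fin n → E3, IsGroundState V z) {δ : ℝ} (hδ : 0 < δ)
    (hsepgs : ∀ (N : ℕ) (x : Fin N → E3), IsGroundState V x →
      ∀ i j, i ≠ j → δ ≤ dist (x i) (x j))
    (h : IsCrystallizing V 3) : HasPeriodicGroundStateEnergy V 3 := by
  obtain ⟨P, hP⟩ := exists_isLocalLimit_of_isCrystallizing hex hδ hsepgs h
  exact hasPeriodicGroundStateEnergy_of_isLocalLimit hV0 hfar h6 hA hcont hstab hex hδ hsepgs hP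

end Summit.AtomisticToContinuum.Crystallization.Theorems.MieRungEnergetic

end
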